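import Literature.AnabelianGeometry.EtaleTheta.LogDivisorModelTateTowerKummer
import Literature.AnabelianGeometry.EtaleTheta.DivisorMonoidsOfGaloisCoveringConnected
import HarnessLib

/-!
# [EtTh] Def. 3.3 (iii): pull-back of a Galois action along a group homomorphism, and the ℤ-TOWER datum of an
# arbitrary group `Γ` with a character `φ : Γ → ℤ` — `Φ₀`, its coordinates, the diagonal, and the constants (class (b))

S. Mochizuki, *The étale theta function …*, Publ. RIMS **45** (2009) [MochizukiEtTh2009], §3, Def. 3.1 / Prop. 3.2 p.70,
Def. 3.3 (iii) / Rmk. 3.3.1 p.73, Def. 3.6 (i)(ii) p.76–77; §1 p.12 (the universal combinatorial covering of a Tate curve is an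
infinite chain of projective lines with Galois group `ℤ` acting by translation) [cite: MochizukiEtTh2009, Def 3.3 p.73].

abc-iut cell, layer L2 [EtTh], seat abc-iut-w5-d179 (gen 6; SUBDAG-EtTh-Thm44 custodian lineage), L2-lead row R505 «ℤ-TOWER
TEMPERED FROBENIOID OVER THE FULL TEMPERED BASE» (STATUS 2026-08-26T16:19Z), FILE 1 of 3.  Consumed BY NAME, nothing restated:
abc-iut-w6-d058's `LogDivisorModel.GaloisAction` record, `GaloisAction.phiZero` / `bZero` / `fZero` / `divZeroHom` /
`divZeroHom_eq_div_iff` / `divAt` (`LogDivisorModelGaloisAction.lean`, `DivisorMonoidsOfGaloisCovering.lean`), the Tate tower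
skeleton `TateTower.model` / `TateTower.action` / `shiftIdx` / `pos` (`LogDivisorModelTateTower.lean`), the pull-back
`GaloisAction.comap A φ` of a Galois action along a group homomorphism (`LogDivisorModelTateTowerKummer.lean`, p457919: this is
how `Π^tp_X` acts on the universal combinatorial covering THROUGH its quotient `Π^tp_X ↠ Gal(Z^log_∞/X^log)`), `isConnectedGSet`
(`DivisorMonoidsOfGaloisCoveringConnected.lean`).

WHAT THIS FILE BUILDS.  Class (b): 10 definitions (`ZTower.mlt`, `ZTower.expC`, `ZTower.expU`, `ZTower.fn`, `ZTower.action`,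
`ZTower.coord`, `ZTower.ones`, `ZTower.diag`, `ZTower.cnstFn`, `ZTower.cnstFnHom`) and their laws (theorems); no Prop-valued
fact, no instance, no notation, no attribute removed, no sorry.
* §1: `comap_id`, the permutation fields of `comap`, and membership in `Φ₀` / `B₀` of a pulled-back action (`Iff.rfl`);
* `ZTower.action φ := TateTower.action.comap φ` — an arbitrary group `Γ` acting on the Tate tower skeleton by translating the
  chain through `φ : Γ →* ℤ`; for a `Γ`-set `S`: `Φ₀(S) = {ψ : S → DIV⁺ | ψ(g·s) = (translation by φ g)(ψ s)}`;
* the bridge `mlt d x` / `expC f` / `expU f` / `fn c k` (multiplicities of a log-divisor of the tower along the prime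
  log-divisor `x`; the exponents of `ϖ` and `U` in a function `ϖ^c U^k`), with the action read on them (`mlt_actDIV`,
  `expC_actFn`, `expU_actFn` — all `rfl`);
* the ℕ-valued COORDINATES `ZTower.coord φ S s n : Φ₀(S) →* ℤ_{≥0}` (multiplicity of `ψ(s)` along the component `n` of the
  chain) — jointly injective (`coord_separating`), `coord (g·s) n = coord s (n − φ g)` (`coord_ρ`);
* the DIAGONAL `ZTower.diag φ S ∈ Φ₀(S)` — the whole special fibre `Σ_n [F_n]` (= the divisor of the uniformiser `ϖ`),
  translation-invariant, every coordinate `1`, `≠ 1` as soon as `S` is nonempty;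
* the CONSTANTS: `ZTower.cnstFn φ S c ∈ F₀(S)` (the constant function `ϖ^c`) with `div₀(ϖ^c) = [diag]^c`
  (`divZeroHom_cnstFn`), and conversely on a CONNECTED `S` every element of `F₀(S)` is some `ϖ^c` (`exists_eq_cnstFn_of_mem_fZero`)
  — so `Φ₀^cnst(S)` is EXACTLY the cyclic group generated by the diagonal (`divZeroHom_mem_zpowers_of_mem_fZero`).
Inputs of the higher-rank tempered-Frobenioid engine of FILE 2 (at `S = Γ/H`, `Φ₀(S)` = the `φ(H)`-periodic effective divisors
on the chain, of rank `|ℤ/φ(H)|`).  HONEST FRAMING: a combinatorial consistency datum for the typed interfaces (not the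
formal-scheme tower of a Tate curve, only its divisor/Galois skeleton); `LogDivisorModel` / `GaloisAction` are interface
records; nothing here bears on [IUTchIII] Cor. 3.12; typed ≠ proved.
-/

noncomputable section

namespace Literature.AnabelianGeometry.EtaleTheta

open CategoryTheory

universe u

namespace LogDivisorModel

/-! ## §1 Pull-back of a Galois-action record along a group homomorphism (`GaloisAction.comap`, p457919): complements -/

namespace GaloisAction

variable {Z : LogDivisorModel.{u}} {G : Type u} [Group G] {Γ : Type u} [Group Γ]

/-- The pulled-back permutation of the cusps is `g ↦ A.permCusp (φ g)`. [cite: MochizukiEtTh2009, Def 3.3 p.73] -/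
@[simp] theorem comap_permCusp (A : Z.GaloisAction G) (φ : Γ →* G) (g : Γ) :
    (A.comap φ).permCusp g = A.permCusp (φ g) := rfl

/-- The pulled-back permutation of the components is `g ↦ A.permComp (φ g)`. [cite: MochizukiEtTh2009, Def 3.3 p.73] -/
@[simp] theorem comap_permComp (A : Z.GaloisAction G) (φ : Γ →* G) (g : Γ) :
    (A.comap φ).permComp g = A.permComp (φ g) := rfl

/-- Pulling back along the identity changes nothing. [cite: MochizukiEtTh2009, Def 3.3 p.73] -/
theorem comap_id (A : Z.GaloisAction G) : A.comap (MonoidHom.id G) = A := rfl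

/-- `Φ₀(S)` of the pulled-back action: the `Γ`-equivariant families of effective Cartier log-divisors, `Γ` acting on
`DIV(Z^log_∞)` through `φ`. [cite: MochizukiEtTh2009, Def 3.3 p.73] -/
theorem mem_phiZero_comap_iff (A : Z.GaloisAction G) (φ : Γ →* G) (S : Action (Type u) Γ) (ψ : S.V → Z.DIV) :
    ψ ∈ (A.comap φ).phiZero S ↔ (∀ s, ψ s ∈ Z.Divplus) ∧ ∀ (g : Γ) (s : S.V), ψ (S.ρ g s) = A.actDIV (φ g) (ψ s) :=
  Iff.rfl

/-- `B₀(S)` of the pulled-back action: the `Γ`-equivariant families of log-meromorphic functions, `Γ` acting on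
`Mero(Z^log_∞)` through `φ`. [cite: MochizukiEtTh2009, Def 3.3 p.73] -/
theorem mem_bZero_comap_iff (A : Z.GaloisAction G) (φ : Γ →* G) (S : Action (Type u) Γ) (b : S.V → Z.Fn) :
    b ∈ (A.comap φ).bZero S ↔ (∀ s, b s ∈ Z.logMero) ∧ ∀ (g : Γ) (s : S.V), b (S.ρ g s) = A.actFn (φ g) (b s) :=
  Iff.rfl

end GaloisAction

/-! ## §2 The ℤ-tower datum of a group `Γ` with a character `φ : Γ →* ℤ` -/

namespace ZTower

open TateTower GaloisAction

/-! ### Bridge: multiplicities and exponents in the Tate tower model (`DIV = ℤ^{components}`, `Fn = ⟨ϖ⟩ × ⟨U⟩`; laws `rfl`) -/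

/-- The multiplicity of the log-divisor `d` of the tower along the prime log-divisor `x` (Def. 3.1 (i): `DIV ≅ ∏ ℤ`).
[cite: MochizukiEtTh2009, Def 3.1 p.70] -/
def mlt (d : model.DIV) (x : TateTower.Idx) : ℤ := Multiplicative.toAdd (α := TateTower.Idx → ℤ) d x

/-- Multiplicities are additive. [cite: MochizukiEtTh2009, Def 3.1 p.70] -/
theorem mlt_mul (a b : model.DIV) (x : TateTower.Idx) : mlt (a * b) x = mlt a x + mlt b x := rfl

/-- The trivial log-divisor has no multiplicity. [cite: MochizukiEtTh2009, Def 3.1 p.70] -/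
theorem mlt_one (x : TateTower.Idx) : mlt 1 x = 0 := rfl

/-- A log-divisor of the tower is determined by its multiplicities. [cite: MochizukiEtTh2009, Def 3.1 p.70] -/
theorem ext_mlt {a b : model.DIV} (h : ∀ x, mlt a x = mlt b x) : a = b :=
  (Multiplicative.toAdd (α := TateTower.Idx → ℤ)).injective (funext h)

/-- Effective = non-negative multiplicities. [cite: MochizukiEtTh2009, Def 3.1 p.70] -/
theorem mem_DIVplus_iff (d : model.DIV) : d ∈ model.DIVplus ↔ ∀ x, 0 ≤ mlt d x := Iff.rfl

/-- An effective Cartier log-divisor has non-negative multiplicities. [cite: MochizukiEtTh2009, Def 3.1 p.70] -/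
theorem mlt_nonneg_of_mem_Divplus {d : model.DIV} (hd : d ∈ model.Divplus) (x : TateTower.Idx) : 0 ≤ mlt d x :=
  (mem_DIVplus_iff d |>.1 (model.Divplus_le_DIVplus hd)) x

/-- In the tower every log-divisor is Cartier, so non-negative multiplicities mean effective Cartier.
[cite: MochizukiEtTh2009, Def 3.1 p.70] -/
theorem mem_Divplus_of_nonneg {d : model.DIV} (h : ∀ x, 0 ≤ mlt d x) : d ∈ model.Divplus := ⟨trivial, h⟩

/-- The exponent of the uniformiser `ϖ` in a function `ϖ^c U^k` of the tower. [cite: MochizukiEtTh2009, Def 3.1 p.70] -/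
def expC (f : model.Fn) : ℤ := (Multiplicative.toAdd (α := ℤ × ℤ) f).1

/-- The exponent of the Tate coordinate `U` in a function `ϖ^c U^k` of the tower. [cite: MochizukiEtTh2009, Def 3.1 p.70] -/
def expU (f : model.Fn) : ℤ := (Multiplicative.toAdd (α := ℤ × ℤ) f).2

/-- The function `ϖ^c U^k` of the tower. [cite: MochizukiEtTh2009, Def 3.1 p.70] -/
def fn (c k : ℤ) : model.Fn := Multiplicative.ofAdd (α := ℤ × ℤ) (c, k)

/-- `expC` is additive. [cite: MochizukiEtTh2009, Def 3.1 p.70] -/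
theorem expC_mul (a b : model.Fn) : expC (a * b) = expC a + expC b := rfl

/-- `expU` is additive. [cite: MochizukiEtTh2009, Def 3.1 p.70] -/
theorem expU_mul (a b : model.Fn) : expU (a * b) = expU a + expU b := rfl

/-- `expC (ϖ^c U^k) = c`. [cite: MochizukiEtTh2009, Def 3.1 p.70] -/
@[simp] theorem expC_fn (c k : ℤ) : expC (fn c k) = c := rfl

/-- `expU (ϖ^c U^k) = k`. [cite: MochizukiEtTh2009, Def 3.1 p.70] -/
@[simp] theorem expU_fn (c k : ℤ) : expU (fn c k) = k := rfl

/-- A function of the tower is determined by its two exponents. [cite: MochizukiEtTh2009, Def 3.1 p.70] -/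
theorem ext_exp {a b : model.Fn} (h₁ : expC a = expC b) (h₂ : expU a = expU b) : a = b :=
  (Multiplicative.toAdd (α := ℤ × ℤ)).injective (Prod.ext h₁ h₂)

/-- The constants of the tower are the `ϖ^c`: `f` is constant iff `U` does not occur. [cite: MochizukiEtTh2009, Def 3.1 p.70] -/
theorem mem_const_iff (f : model.Fn) : f ∈ model.const ↔ expU f = 0 := by
  constructor
  · rintro ⟨c, rfl⟩
    rfl
  · intro h
    exact ⟨Multiplicative.ofAdd (expC f), ext_exp rfl h.symm⟩

/-- `ϖ^c` is a constant. [cite: MochizukiEtTh2009, Def 3.1 p.70] -/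
theorem fn_zero_mem_const (c : ℤ) : fn c 0 ∈ model.const := ⟨Multiplicative.ofAdd c, rfl⟩

/-- The divisor of `ϖ^c U^k` has multiplicity `c + k·n` along the component `n` (Def. 3.1 (ii) for the tower).
[cite: MochizukiEtTh2009, Def 3.1 p.70] -/
theorem mlt_divisor (f : model.logMero) (x : TateTower.Idx) : mlt (model.divisor f) x = expC f.1 + expU f.1 * pos x := rfl

variable {Γ : Type} [Group Γ] (φ : Γ →* Multiplicative ℤ)

/-- **The ℤ-tower action**: `Γ` acting on the Tate tower skeleton by translating the chain through `φ`.
[cite: MochizukiEtTh2009, Def 3.3 p.73] -/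
def action : model.GaloisAction Γ := TateTower.action.comap φ

/-- The action on log-divisors is translation by `φ g`: the multiplicity of `g·d` along `x` is that of `d` along `x − φ g`.
[cite: MochizukiEtTh2009, Def 3.3 p.73] -/
theorem mlt_actDIV (g : Γ) (d : model.DIV) (x : TateTower.Idx) :
    mlt ((action φ).actDIV g d) x = mlt d ((shiftIdx (Multiplicative.toAdd (φ g))).symm x) := rfl

/-- The action on log-divisors along the components: `mlt (g·d) n = mlt d (n − φ g)`. [cite: MochizukiEtTh2009, Def 3.3 p.73] -/
theorem mlt_actDIV_inr (g : Γ) (d : model.DIV) (n : ℤ) :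
    mlt ((action φ).actDIV g d) (Sum.inr n) = mlt d (Sum.inr (n - Multiplicative.toAdd (φ g))) := by
  rw [mlt_actDIV, shiftIdx_symm_inr]

/-- The action on functions is the shear `ϖ^c U^k ↦ ϖ^{c − k·φ g} U^k`: the `ϖ`-exponent. [cite: MochizukiEtTh2009, Def 3.3 p.73] -/
theorem expC_actFn (g : Γ) (f : model.Fn) :
    expC ((action φ).actFn g f) = expC f - expU f * Multiplicative.toAdd (φ g) := rfl

/-- The action on functions does not change the `U`-exponent. [cite: MochizukiEtTh2009, Def 3.3 p.73] -/
theorem expU_actFn (g : Γ) (f : model.Fn) : expU ((action φ).actFn g f) = expU f := rfl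

/-- Constants are fixed by the action. [cite: MochizukiEtTh2009, Def 3.3 p.73] -/
theorem actFn_of_mem_const (g : Γ) {f : model.Fn} (hf : f ∈ model.const) : (action φ).actFn g f = f :=
  ext_exp (by rw [expC_actFn, (mem_const_iff f).1 hf, zero_mul, sub_zero]) (expU_actFn φ g f)

variable (S : Action (Type 0) Γ)

/-- An element of `Φ₀(S)` has non-negative multiplicities. [cite: MochizukiEtTh2009, Def 3.1 p.70] -/
theorem mlt_nonneg (ψ : (action φ).phiZero S) (s : S.V) (x : TateTower.Idx) : 0 ≤ mlt (ψ.1 s) x :=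
  mlt_nonneg_of_mem_Divplus (ψ.2.1 s) x

/-- Equivariance of an element of `Φ₀(S)`, read on multiplicities: `mlt (ψ (g·s)) n = mlt (ψ s) (n − φ g)`.
[cite: MochizukiEtTh2009, Def 3.3 p.73] -/
theorem mlt_ρ (ψ : (action φ).phiZero S) (g : Γ) (s : S.V) (n : ℤ) :
    mlt (ψ.1 (S.ρ g s)) (Sum.inr n) = mlt (ψ.1 s) (Sum.inr (n - Multiplicative.toAdd (φ g))) := by
  rw [ψ.2.2 g s, mlt_actDIV_inr]

/-- Two elements of `Φ₀(S)` with the same multiplicities along every component at every point are equal (there are no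
cusps). [cite: MochizukiEtTh2009, Def 3.1 p.70] -/
theorem phiZero_ext {ψ ψ' : (action φ).phiZero S}
    (h : ∀ (s : S.V) (n : ℤ), mlt (ψ.1 s) (Sum.inr n) = mlt (ψ'.1 s) (Sum.inr n)) : ψ = ψ' := by
  refine Subtype.ext (funext fun s => ext_mlt fun x => ?_)
  rcases x with c | n
  · exact c.elim
  · exact h s n

/-! ### Coordinates -/

/-- **The coordinate `(s, n)`**: the multiplicity of `ψ(s)` along the component `F_n` of the chain, a monoid homomorphism
`Φ₀(S) → ℤ_{≥0}` (Def. 3.1 (i): `DIV⁺ ≅ ∏ ℤ_{≥0}`). [cite: MochizukiEtTh2009, Def 3.1 p.70] -/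
def coord (s : S.V) (n : ℤ) : (action φ).phiZero S →* Multiplicative ℕ where
  toFun ψ := Multiplicative.ofAdd (mlt (ψ.1 s) (Sum.inr n)).toNat
  map_one' := by
    simp only [OneMemClass.coe_one, Pi.one_apply, mlt_one, Int.toNat_zero, ofAdd_zero]
  map_mul' ψ ψ' := by
    simp only [Submonoid.coe_mul, Pi.mul_apply, mlt_mul]
    rw [Int.toNat_add (mlt_nonneg φ S ψ s _) (mlt_nonneg φ S ψ' s _), ofAdd_add]

/-- The coordinate, unfolded. [cite: MochizukiEtTh2009, Def 3.1 p.70] -/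
theorem coord_apply (s : S.V) (n : ℤ) (ψ : (action φ).phiZero S) :
    coord φ S s n ψ = Multiplicative.ofAdd (mlt (ψ.1 s) (Sum.inr n)).toNat := rfl

/-- The coordinate as an integer is the multiplicity itself. [cite: MochizukiEtTh2009, Def 3.1 p.70] -/
theorem coord_natCast (s : S.V) (n : ℤ) (ψ : (action φ).phiZero S) :
    ((Multiplicative.toAdd (coord φ S s n ψ) : ℕ) : ℤ) = mlt (ψ.1 s) (Sum.inr n) := by
  rw [coord_apply, toAdd_ofAdd]
  exact Int.toNat_of_nonneg (mlt_nonneg φ S ψ s _)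

/-- **The coordinates are jointly injective.** [cite: MochizukiEtTh2009, Def 3.1 p.70] -/
theorem coord_separating {ψ ψ' : (action φ).phiZero S} (h : ∀ (s : S.V) (n : ℤ), coord φ S s n ψ = coord φ S s n ψ') :
    ψ = ψ' :=
  phiZero_ext φ S fun s n => by rw [← coord_natCast, ← coord_natCast, h s n]

/-- Coordinates along one orbit determine each other: `coord (g·s) n = coord s (n − φ g)`.
[cite: MochizukiEtTh2009, Def 3.3 p.73] -/
theorem coord_ρ (g : Γ) (s : S.V) (n : ℤ) (ψ : (action φ).phiZero S) :
    coord φ S (S.ρ g s) n ψ = coord φ S s (n - Multiplicative.toAdd (φ g)) ψ := by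
  rw [coord_apply, coord_apply, mlt_ρ]

/-! ### The diagonal (the special fibre `Σ_n [F_n] = div ϖ`) -/

/-- The all-ones log-divisor `Σ_n [F_n]` of the chain (the divisor of the uniformiser). [cite: MochizukiEtTh2009, Def 3.1 p.70] -/
def ones : model.DIV := Multiplicative.ofAdd (α := TateTower.Idx → ℤ) fun _ => 1

/-- `Σ_n [F_n]` has every multiplicity `1`. [cite: MochizukiEtTh2009, Def 3.1 p.70] -/
@[simp] theorem mlt_ones (x : TateTower.Idx) : mlt ones x = 1 := rfl

/-- `Σ_n [F_n]` is an effective Cartier log-divisor of the tower. [cite: MochizukiEtTh2009, Def 3.1 p.70] -/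
theorem ones_mem_Divplus : ones ∈ model.Divplus := mem_Divplus_of_nonneg fun x => by rw [mlt_ones]; exact zero_le_one

/-- `Σ_n [F_n]` is translation-invariant. [cite: MochizukiEtTh2009, Def 3.3 p.73] -/
theorem actDIV_ones (g : Γ) : (action φ).actDIV g ones = ones := ext_mlt fun x => by rw [mlt_actDIV, mlt_ones, mlt_ones]

/-- **The diagonal `diag S ∈ Φ₀(S)`**: the constant family `s ↦ Σ_n [F_n]` (translation-invariant, hence equivariant).
[cite: MochizukiEtTh2009, Def 3.3 p.73] -/
def diag : (action φ).phiZero S := ⟨fun _ => ones, fun _ => ones_mem_Divplus, fun g _ => (actDIV_ones φ g).symm⟩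

/-- The diagonal, evaluated. [cite: MochizukiEtTh2009, Def 3.3 p.73] -/
@[simp] theorem diag_apply (s : S.V) : (diag φ S).1 s = ones := rfl

/-- **Every coordinate of the diagonal is `1`.** [cite: MochizukiEtTh2009, Def 3.1 p.70] -/
@[simp] theorem coord_diag (s : S.V) (n : ℤ) : coord φ S s n (diag φ S) = Multiplicative.ofAdd 1 := rfl

/-- Every coordinate of `diag^k` is `k`. [cite: MochizukiEtTh2009, Def 3.1 p.70] -/
theorem coord_diag_pow (s : S.V) (n : ℤ) (k : ℕ) : coord φ S s n (diag φ S ^ k) = Multiplicative.ofAdd k := by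
  rw [map_pow, coord_diag, ← ofAdd_nsmul, smul_eq_mul, mul_one]

/-- **The diagonal is non-trivial** over a nonempty `S`. [cite: MochizukiEtTh2009, Def 3.3 p.73] -/
theorem diag_ne_one [Nonempty S.V] : diag φ S ≠ 1 := fun h => by
  have h1 := congrArg (fun ψ => coord φ S (Classical.arbitrary S.V) 0 ψ) h
  simp only [coord_diag, map_one] at h1
  exact one_ne_zero (ofAdd_eq_one.mp h1)

/-- An element of `Φ₀(S)` all of whose coordinates equal `k` is `diag^k`. [cite: MochizukiEtTh2009, Def 3.1 p.70] -/
theorem eq_diag_pow_of_coord_eq {ψ : (action φ).phiZero S} {k : ℕ}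
    (h : ∀ (s : S.V) (n : ℤ), coord φ S s n ψ = Multiplicative.ofAdd k) : ψ = diag φ S ^ k :=
  coord_separating φ S fun s n => by rw [h, coord_diag_pow]

/-! ### The constants `F₀(S)` and their divisors -/

/-- **The constant function `ϖ^c` as an element of `B₀(S)`** (constant family; equivariant because constants are
translation-fixed). [cite: MochizukiEtTh2009, Def 3.3 p.73] -/
def cnstFn (c : ℤ) : (action φ).bZero S :=
  ⟨fun _ => fn c 0, fun _ => trivial, fun g _ => (actFn_of_mem_const φ g (fn_zero_mem_const c)).symm⟩

/-- `cnstFn c` evaluated. [cite: MochizukiEtTh2009, Def 3.3 p.73] -/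
@[simp] theorem cnstFn_apply (c : ℤ) (s : S.V) : (cnstFn φ S c).1 s = fn c 0 := rfl

/-- `ϖ^c ∈ F₀(S)`. [cite: MochizukiEtTh2009, Def 3.3 p.73] -/
theorem cnstFn_mem_fZero (c : ℤ) : cnstFn φ S c ∈ (action φ).fZero S := fun _ => fn_zero_mem_const c

/-- `c ↦ ϖ^c` is additive. [cite: MochizukiEtTh2009, Def 3.3 p.73] -/
theorem cnstFn_add (c c' : ℤ) : cnstFn φ S (c + c') = cnstFn φ S c * cnstFn φ S c' :=
  Subtype.ext (funext fun _ => ext_exp rfl rfl)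

/-- `ϖ^0 = 1`. [cite: MochizukiEtTh2009, Def 3.3 p.73] -/
@[simp] theorem cnstFn_zero : cnstFn φ S 0 = 1 := Subtype.ext (funext fun _ => ext_exp rfl rfl)

/-- `c ↦ ϖ^c` as a homomorphism `ℤ → B₀(S)`. [cite: MochizukiEtTh2009, Def 3.3 p.73] -/
def cnstFnHom : Multiplicative ℤ →* (action φ).bZero S where
  toFun c := cnstFn φ S (Multiplicative.toAdd c)
  map_one' := cnstFn_zero φ S
  map_mul' c c' := by
    show cnstFn φ S (Multiplicative.toAdd (c * c')) = cnstFn φ S (Multiplicative.toAdd c) * cnstFn φ S (Multiplicative.toAdd c')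
    rw [toAdd_mul, cnstFn_add]

/-- `cnstFnHom (ofAdd c) = cnstFn c`. [cite: MochizukiEtTh2009, Def 3.3 p.73] -/
@[simp] theorem cnstFnHom_ofAdd (c : ℤ) : cnstFnHom φ S (Multiplicative.ofAdd c) = cnstFn φ S c := rfl

/-- The divisor of `b ∈ B₀(S)` at a point, read on multiplicities: `mlt (div (b s)) n = expC (b s) + expU (b s)·n`.
[cite: MochizukiEtTh2009, Def 3.1 p.70] -/
theorem mlt_divAt (b : (action φ).bZero S) (s : S.V) (x : TateTower.Idx) :
    mlt ((action φ).divAt S b s) x = expC (b.1 s) + expU (b.1 s) * pos x := rfl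

/-- The divisor of the function `ϖ^c` has every multiplicity `c`. [cite: MochizukiEtTh2009, Def 3.1 p.70] -/
theorem mlt_divAt_cnstFn (c : ℤ) (s : S.V) (x : TateTower.Idx) : mlt ((action φ).divAt S (cnstFn φ S c) s) x = c := by
  rw [mlt_divAt, cnstFn_apply, expC_fn, expU_fn, zero_mul, add_zero]

/-- **`div(ϖ) = Σ_n [F_n]`** at every point. [cite: MochizukiEtTh2009, Def 3.3 p.73] -/
theorem divAt_cnstFn_one (s : S.V) : (action φ).divAt S (cnstFn φ S 1) s = ones :=
  ext_mlt fun x => by rw [mlt_divAt_cnstFn, mlt_ones]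

/-- **`div₀(ϖ) = [diag]`**: the divisor of the uniformiser is the diagonal. [cite: MochizukiEtTh2009, Def 3.3 p.73] -/
theorem divZeroHom_cnstFn_one : (action φ).divZeroHom S (cnstFn φ S 1) = Algebra.GrothendieckGroup.of (diag φ S) := by
  have h : (action φ).divZeroHom S (cnstFn φ S 1) =
      Algebra.GrothendieckGroup.of (diag φ S) / Algebra.GrothendieckGroup.of 1 :=
    ((action φ).divZeroHom_eq_div_iff S _ _ _).2 fun s => by
      rw [OneMemClass.coe_one, Pi.one_apply, mul_one, diag_apply, divAt_cnstFn_one]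
  rw [h, map_one, div_one]

/-- **`div₀(ϖ^c) = [diag]^c`.** [cite: MochizukiEtTh2009, Def 3.3 p.73] -/
theorem divZeroHom_cnstFn (c : ℤ) :
    (action φ).divZeroHom S (cnstFn φ S c) = Algebra.GrothendieckGroup.of (diag φ S) ^ c := by
  rw [← cnstFnHom_ofAdd, ← divZeroHom_cnstFn_one, ← cnstFnHom_ofAdd φ S 1, ← map_zpow, ← map_zpow, ← ofAdd_zsmul,
    smul_eq_mul, mul_one]

variable {S}

/-- **On a CONNECTED `S` every element of `F₀(S)` is a constant function `ϖ^c`** (an equivariant family of constants on one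
orbit is constant, constants being translation-fixed). [cite: MochizukiEtTh2009, Prop 3.4 p.74] -/
theorem exists_eq_cnstFn_of_mem_fZero (hS : isConnectedGSet S) {b : (action φ).bZero S} (hb : b ∈ (action φ).fZero S) :
    ∃ c : ℤ, b = cnstFn φ S c := by
  obtain ⟨⟨s₀⟩, htrans⟩ := (isConnectedGSet_iff S).1 hS
  refine ⟨expC (b.1 s₀), Subtype.ext (funext fun s => ?_)⟩
  obtain ⟨g, rfl⟩ := htrans s₀ s
  rw [b.2.2 g s₀, actFn_of_mem_const φ g (hb s₀), cnstFn_apply]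
  exact ext_exp rfl ((mem_const_iff _).1 (hb s₀))

/-- **`Φ₀^cnst(S)` is the cyclic group of the diagonal** (connected `S`): the divisor of every constant is an integer power of
`[diag]`. [cite: MochizukiEtTh2009, Def 3.3 p.73] -/
theorem divZeroHom_mem_zpowers_of_mem_fZero (hS : isConnectedGSet S) {b : (action φ).bZero S}
    (hb : b ∈ (action φ).fZero S) :
    (action φ).divZeroHom S b ∈ Subgroup.zpowers (Algebra.GrothendieckGroup.of (diag φ S)) := by
  obtain ⟨c, rfl⟩ := exists_eq_cnstFn_of_mem_fZero φ hS hb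
  rw [divZeroHom_cnstFn]
  exact ⟨c, rfl⟩

/-- Conversely every power of `[diag]` is the divisor of a constant (`ϖ^c`), on any `S`. [cite: MochizukiEtTh2009, Def 3.3 p.73] -/
theorem zpowers_le_divZeroHom_fZero (c : ℤ) :
    ∃ b ∈ (action φ).fZero S, (action φ).divZeroHom S b = Algebra.GrothendieckGroup.of (diag φ S) ^ c :=
  ⟨cnstFn φ S c, cnstFn_mem_fZero φ S c, divZeroHom_cnstFn φ S c⟩

/-! ### Non-vacuity -/

/-- **Non-vacuity**: at `φ = id` the ℤ-tower datum is the Tate tower action of record. [cite: MochizukiEtTh2009, Def 3.3 p.73] -/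
theorem action_id : action (MonoidHom.id (Multiplicative ℤ)) = TateTower.action := rfl

/-- The diagonal of the regular `Γ`-set is a non-trivial element of `Φ₀(Γ/1)`, for every `Γ` and `φ`.
[cite: MochizukiEtTh2009, Def 3.3 p.73] -/
theorem diag_leftRegular_ne_one : diag φ (Action.leftRegular Γ) ≠ 1 :=
  haveI : Nonempty (Action.leftRegular Γ).V := ⟨(1 : Γ)⟩
  diag_ne_one φ _

end ZTower

end LogDivisorModel

end Literature.AnabelianGeometry.EtaleTheta

end
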